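import Summits.QuantumFields.YangMills.Theorems.FluctuationComparisonRegPrIntLS2BetaSourceClassesOfBkg
import Summits.QuantumFields.YangMills.Theorems.FluctuationComparisonRegPrIntLS2BetaSourceEnergyLinearShareOfVol
import HarnessLib

/-!
# S2β · (SCT″-c)₁ — «THE c₁ LETTER KNIT ON THE LINEAR ROAD»: ✓p838904 `c1Budget_of_letters` with its three CLASS letters and the LINEAR source energy DISCHARGED —
# classes ⟸ the station's (BKG) binder (✓p839707 (a) `exists_srcClasses_of_bkg'`), sizes `M :=` the ℓ²-corner size (✓p839415 `cornerM_*`), row energy ⟸ ✓p839415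
# `Bsrc_split_le`, linear energy ⟸ ✓p839746 `Elin_le_Sprime` (px10) ∘ (V1)∕(V2) `Elin_le_beta_Sprime` (px12 g27, the VOLUME road (L2-VOL), desk RULING №128) —
# ONE name `c1Budget_of_bkg_letters` whose remaining hypotheses are (BKG) + ONE smallness, (T), the second-order remainder letter `R`, the weights `w ≤ L^{K−J−1−j}`:
# `Σ_{t<K−J} L^t·c₁(t) ≤ 2·(2·Cst·C₅)·(4·L⁻¹·(L^{K−J}·REL) + W·(12d²Γ²(2C_Bα)²·S′∕L + 48·E_R + 3·E_J)) + 2·(256·Cst·M̄²·C_cov)·S′`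

Cell `ym3-torus` (YM ladder rung R3 = continuum `SU(2)` Yang–Mills on the three-torus at fixed lattice data — a RUNG: NOT d = 4, NOT infinite volume, NOT a mass gap,
NOT Clay).  Width seat `ym-ust-20520-w4` (gen 29); crux `stmt-QuantumFields-20520`, LINE g18-1 S2β; piece (b) «c₁-KNIT» (LEAD №53, architect px17 g23 2026-09-01T01:39:20Z (1) GO).
`--kind proof --supports stmt-QuantumFields-20520 --as helper`, count-neutral, DEFINITION-FREE (0 `def`, 0 `instance`, 0 `notation`, 0 `sorry`, default heartbeats).

WHAT IS PROVED (sorry-free; composition BY NAME, zero new letters).  ★★★`c1Budget_of_bkg_letters`: hypotheses = ✓`c1Budget_of_letters`' (`hJK Cst U₀ ζ w hw W hW X hXdef Mg hMg hMg4`,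
`R hR0 hR`, `Mbar hM0 hM1 hM`) with the class binders `α δ αp hα hα24 hαδ hα0 hδ hUs hαp0 hαp` REPLACED by `C_B α hCB hα hpos hBKG h24 hSU` ((BKG) = the bytes of
✓`supTowerLetter_of_liftLadderLetter''`; ONE smallness `(((d+2)L)²∕4)·C_B·α ≤ 1∕24 ∧ < δ_SU`), the size binders `M hM' hXM` GONE (ℓ²-corner size), the energy binders `Bsrc hBsrc`
GONE, and ONE weight domination `hwdom : w(i+1) ≤ L^{K−J−1−(i+1)}` (the consumer's `w`, `W` stay free — e.g. `w j := L^{K−J−1−j}` for `j ≤ K−J`, `2^j` beyond, `W = 4`);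
conclusion = ✓p838904's c₁ TEXT with `Bsrc :=` **`12·d²·Γ²·(2C_Bα)²·S′∕L + 48·E_R(w,R) + 3·E_J(w,X)`** (`Γ` = ✓p839608's at `kα := ((d+2)L)²∕4`, `kp := L²`; `S′` = the station's
READ′₂ cell-sup energy text, the same bytes as the c₁ letter's own second term; `E_R := Σ_i w(i+1)·L^{K−J−1−(i+1)}·Σ_{μ,ν,y′} R²`; `E_J := Σ_i w(i+1)·L^{…}·Σ_{μ,ν,y′} junction₀(X)²`).
Proof: `exists_srcClasses_of_bkg'` at `Cθ := 2C_Bα` ⊕ `Elin_le_beta_Sprime` ⊕ (`cornerM_nonneg`, `cornerM_dominates`, `cornerM_energy` packaged as an opaque `∃ M`) ⊕ `Bsrc_split_le`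
⊕ the weight monotonicity `w(i+1)·(…) ≤ L^{K−J−1−(i+1)}·(…)` (`gcongr`) ⊕ `c1Budget_of_letters`.

DOMAIN LINE (plan (3) v3 → v4; architect px17 g23 2026-09-01T00:41:39Z∕01:39:20Z∕02:00:25Z (S1), desk RULINGs №124∕№128∕№130).  On the c₁ column the LINEAR source
energy is an `S′`-share BY KERNEL (this file: class decay (BKG) × volume (L2-VOL), NO gauge condition, NO ℓ²-tower letter — the naked (L2-TOWER) is REFUTED by kernel,
✓`…L2TowerContractionFalse` (px20 g25), and (L2-TOWER)@rep is STRUCK (S1): no K-uniform consumer); of the second-order remainder `R` (`E_R`): the plaquette×chord² piece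
`δM²` is affordable (class (a) of «SRC-VOL»), the `O_h·M`, `O_h²` pieces are CONDITIONAL on (REG) AT THE THM-2 REPRESENTATIVE on the VOLUME road — `E_R ⟸` (V4)
`…RowEnergyShareOfVol` (px12 g27) ∘ (REG-UP)@rep {ratio ✓p839850 `hOSC_tower`; size profiles = row (REG-UP) C} ∘ (RES-u) {✓p839678, ✓p839557, ✓p839644, ✓p839687,
DOOR, FEED, …} ⊕ cubic — with `B8Thm2AtT3Members` a theorem for `L ≥ 5` and the hypothesis `hThm2S3` at `L = 3`; the junction energy `E_J` is (REG)-class at the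
representative ((SUP-DECAY)₀ = Thm 2's sup letter; px21 (JNC-E), architect «WEIGHT LINE» v2 2026-09-01T01:53:02Z: `w 1 := 1`). [Balaban1985RegularSpaces] Thm 2 (1.36) p.83;
[Balaban1985Averaging] Prop. 4 (128)–(135) pp.37–38; [Balaban1987RG1] (0.1)–(0.4), (0.11), (0.18) pp.251–255.

HONEST SCOPE.  Composition of landed letters; nothing of Bałaban's renormalisation-group analysis is asserted or proved; (BKG), (T), `R`∕`E_R`, `E_J`'s pricing, the windows
are HYPOTHESES or others'; GAP♯∘ (`stub_uniformFibreGapOrbit`, registry 3732b7df UNTOUCHED, 0∕5), S2β, the five registered stubs, crux 20520, 19936, 19200 and `YM3TorusSU2`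
are NOT proved; no registered stub is closed; rung R3 — NOT d = 4, NOT infinite volume, NOT a mass gap, NOT Clay; the Yang–Mills mass gap is NOT proved.
-/

set_option autoImplicit false

noncomputable section

open scoped Matrix.Norms.L2Operator
open Finset

namespace Summit.QuantumFields.YangMills.Theorems.FluctuationComparisonRegPrIntLS2BetaCurlBudgetOfBkg

open Literature.MathematicalPhysics.QuantumFieldTheory.Balaban1983to89
open Literature.MathematicalPhysics.QuantumFieldTheory.Balaban1983to89.T4Continuum
open Literature.MathematicalPhysics.QuantumFieldTheory.Balaban1983to89.T3ContinuumYM3Torus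
open Literature.MathematicalPhysics.QuantumFieldTheory.Balaban1983to89.T3LevelShift
open Literature.MathematicalPhysics.QuantumFieldTheory.Balaban1983to89.T3TiltDescent
open Literature.MathematicalPhysics.QuantumFieldTheory.Balaban1983to89.T3UnitLawDensityEML (ℰp)
open Literature.MathematicalPhysics.QuantumFieldTheory.Balaban1983to89.T4HaarSU2ExpChart (expPoint)
open Literature.MathematicalPhysics.QuantumFieldTheory.Balaban1983to89.T4ExpWindowSmallField (logVec)
open Literature.MathematicalPhysics.QuantumFieldTheory.Balaban1983to89.HaarExponentialChart
open Literature.MathematicalPhysics.QuantumFieldTheory.Balaban1983to89.HaarExponentialChart.IsChartRep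
open Literature.MathematicalPhysics.QuantumFieldTheory.Balaban1983to89.BlockAveraging (Idx blockAvg avgFun loopHol)
open Literature.MathematicalPhysics.QuantumFieldTheory.Balaban1983to89.ExpMeanLog (expMeanLogSU deltaSU)
open Literature.MathematicalPhysics.QuantumFieldTheory.Balaban1983to89.BlockAveragingEMLLinearisedBackground (covWalkSum)
open Literature.MathematicalPhysics.QuantumFieldTheory.Balaban1983to89.B10Eq47AxialChi (shiftN)
open Literature.MathematicalPhysics.QuantumFieldTheory.Balaban1983to89.B14.Eq22Determines (blockIter)
open Literature.MathematicalPhysics.QuantumFieldTheory.Balaban1983to89.B10Eq27TorusAxialLog (rel)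
open Literature.MathematicalPhysics.QuantumFieldTheory.Balaban1983to89.B10Eq18SigmaSU2 (su2Coord)
open Literature.MathematicalPhysics.QuantumFieldTheory.Balaban1983to89.B10Eq18SigmaSU2Haar (rev)
open Literature.MathematicalPhysics.QuantumLattice (su2Quat)
open Summit.QuantumFields.YangMills.Theorems.FluctuationComparisonRegPrIntLS2BetaChartReadDescentOntoExpPoint (su2Coord_rev_mem_lie)
open Summit.QuantumFields.YangMills.Theorems.FluctuationComparisonRegPrIntLS2BetaCurlBudgetLetter (c1Budget_of_letters)
open Summit.QuantumFields.YangMills.Theorems.FluctuationComparisonRegPrIntLS2BetaSourceRowEnergySplit (Bsrc_split_le cornerM_nonneg cornerM_dominates cornerM_energy)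
open Summit.QuantumFields.YangMills.Theorems.FluctuationComparisonRegPrIntLS2BetaSourceClassesOfBkg (exists_srcClasses_of_bkg')
open Summit.QuantumFields.YangMills.Theorems.FluctuationComparisonRegPrIntLS2BetaSourceEnergyLinearShareOfVol (Elin_le_beta_Sprime)

variable (F : T3Family)

/-- ★★★ **THE c₁ LETTER KNIT ON THE LINEAR ROAD** — ✓`c1Budget_of_letters` with the class letters read off (BKG) (✓`exists_srcClasses_of_bkg'`), the ℓ²-corner size,
✓`Bsrc_split_le` and the volume-road linear share ✓`Elin_le_beta_Sprime`; see the module header for the hypothesis∕conclusion ledger and the DOMAIN LINE.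
[cite: Balaban1985Averaging, (19)-(20) p.21 and Prop. 4 (128)-(135) pp.37-38; Balaban1987RG1, (0.1)-(0.4), (0.11), (0.18) pp.251-255] -/
theorem c1Budget_of_bkg_letters {J K : ℕ} (hJK : J ≤ K) (Cst : ℝ) (hCst : 0 ≤ Cst)
    (U₀ : GaugeField (F.P K) 0 (Matrix.specialUnitaryGroup (Fin 2) ℂ)) (ζ : PBond (F.P K) 0 → EuclideanSpace ℝ (Fin 3))
    (w : ℕ → ℝ) (hw : ∀ j, 0 < w j) (W : ℝ) (hW : ∀ n, ∑ j ∈ Finset.Icc 1 n, (w j)⁻¹ ≤ W)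
    (X : (i : ℕ) → PBond (F.P K) i → (specialUnitaryLogChart (Fin 2)).lie)
    (hXdef : X = fun (i : ℕ) (b : PBond (F.P K) i) =>
      (⟨su2Coord (rev (logVec (su2Quat (Averaging.iter (fun k => BlockAveraging.blockAvg (P := F.P K) (j := k) ℰp) i (fun ℓ => expPoint (ζ ℓ) * U₀ ℓ : GaugeField (F.P K) 0 (Matrix.specialUnitaryGroup (Fin 2) ℂ)) b * (Averaging.iter (fun k => BlockAveraging.blockAvg (P := F.P K) (j := k) ℰp) i U₀ b)⁻¹)))), su2Coord_rev_mem_lie _⟩ : (specialUnitaryLogChart (Fin 2)).lie))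
    (Mg : ℕ → ℝ) (hMg : ∀ t, t ≤ K - J → ∀ b : PBond (F.P K) t,
      ‖logVec (su2Quat (Averaging.iter (fun k => BlockAveraging.blockAvg (P := F.P K) (j := k) ℰp) t (fun ℓ => expPoint (ζ ℓ) * U₀ ℓ : GaugeField (F.P K) 0 (Matrix.specialUnitaryGroup (Fin 2) ℂ)) b * (Averaging.iter (fun k => BlockAveraging.blockAvg (P := F.P K) (j := k) ℰp) t U₀ b)⁻¹))‖ ≤ Mg t)
    (hMg4 : ∀ t, t ≤ K - J → Mg t ≤ 1 / 4)
    (C_B α : ℝ) (hCB : 0 ≤ C_B) (hα : 0 ≤ α) (hpos : 0 < C_B * α)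
    (hBKG : ∀ t, t ≤ K - J → ∀ p : Plaq (F.P K) t,
      dist1 (GaugeField.plaqHol (Averaging.iter (fun k => BlockAveraging.blockAvg (P := F.P K) (j := k) ℰp) t U₀) p) ≤
        C_B * α * (F.L : ℝ) ^ (2 * t) * ((F.L : ℝ)⁻¹) ^ (2 * (K - J)))
    (h24 : ((((F.P K).d + 2) * (F.P K).L : ℕ) : ℝ) ^ 2 / 4 * (C_B * α) ≤ 1 / 24)
    (hSU : ((((F.P K).d + 2) * (F.P K).L : ℕ) : ℝ) ^ 2 / 4 * (C_B * α) < deltaSU (Fin 2))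
    (hwdom : ∀ i, i < K - J → w (i + 1) ≤ (F.L : ℝ) ^ (K - J - 1 - (i + 1)))
    (R : Fin (F.P K).d → Fin (F.P K).d → (i : ℕ) → Site (F.P K) i → ℝ) (hR0 : ∀ μ ν i x, 0 ≤ R μ ν i x)
    (hR : ∀ μ ν : Fin (F.P K).d, μ < ν → ∀ i, i < K - J → ∀ (y' : Site (F.P K) (i + 1)) (c : PBond (F.P K) (i + 1)),
      (c = ⟨y', μ⟩ ∨ c = ⟨y'.shift μ, ν⟩ ∨ c = ⟨y'.shift ν, μ⟩ ∨ c = ⟨y', ν⟩) →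
      ‖(((isChartRep_specialUnitaryGroup (n := Fin 2)).logChart (avgFun (expMeanLogSU (n := Fin 2)) (fun b => (isChartRep_specialUnitaryGroup (n := Fin 2)).expChart (X i b) * Averaging.iter (fun k => BlockAveraging.blockAvg (P := F.P K) (j := k) ℰp) i U₀ b) c * (avgFun (expMeanLogSU (n := Fin 2)) (Averaging.iter (fun k => BlockAveraging.blockAvg (P := F.P K) (j := k) ℰp) i U₀) c)⁻¹) : (specialUnitaryLogChart (Fin 2)).lie) : Matrix (Fin 2) (Fin 2) ℂ) -
        ((fderiv ℝ (fun (A : PBond (F.P K) i → (specialUnitaryLogChart (Fin 2)).lie) (c : PBond (F.P K) (i + 1)) => (isChartRep_specialUnitaryGroup (n := Fin 2)).logChart (avgFun (expMeanLogSU (n := Fin 2)) (fun b => (isChartRep_specialUnitaryGroup (n := Fin 2)).expChart (A b) * Averaging.iter (fun k => BlockAveraging.blockAvg (P := F.P K) (j := k) ℰp) i U₀ b) c * (avgFun (expMeanLogSU (n := Fin 2)) (Averaging.iter (fun k => BlockAveraging.blockAvg (P := F.P K) (j := k) ℰp) i U₀) c)⁻¹)) 0 (X i) c : (specialUnitaryLogChart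 (Fin 2)).lie) : Matrix (Fin 2) (Fin 2) ℂ)‖ ≤ R μ ν (i + 1) y')
    (Mbar : ℝ) (hM0 : 0 ≤ Mbar) (hM1 : 4 * Mbar ≤ 1)
    (hM : ∀ s, s < K - J → ∀ b : PBond (F.P K) s, ‖logVec (su2Quat (Averaging.iter (fun k => BlockAveraging.blockAvg (P := F.P K) (j := k) ℰp) s (fun ℓ => expPoint (ζ ℓ) * U₀ ℓ : GaugeField (F.P K) 0 (Matrix.specialUnitaryGroup (Fin 2) ℂ)) b * (Averaging.iter (fun k => BlockAveraging.blockAvg (P := F.P K) (j := k) ℰp) s U₀ b)⁻¹))‖ ≤ Mbar) :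
    ∑ t ∈ Finset.range (K - J), (F.L : ℝ) ^ t * (fun t => Cst * ∑ B : PBond (F.P J) 0,
      ‖(fun p : Plaq (F.P K) (K - J - 1 - t) =>
        if ∃ z₀ : Site (F.P K) 0, (blockIter (K - J) z₀ = (bondShift (F.sitesPerDir_eq (m := F.m) (K := J) (j := 0) (m' := F.m) (K' := K) (j' := K - J) (by omega)) B).src ∨
            blockIter (K - J) z₀ = (bondShift (F.sitesPerDir_eq (m := F.m) (K := J) (j := 0) (m' := F.m) (K' := K) (j' := K - J) (by omega)) B).tgt) ∧
            ∀ κ, (rel (blockIter (K - J - 1 - t) z₀) p.src κ).natAbs ≤ (2 * F.L + 1)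
        then dist1 ((GaugeField.plaqHol (Averaging.iter (fun k => BlockAveraging.blockAvg (P := F.P K) (j := k) ℰp) (K - J - 1 - t) U₀) p)⁻¹ *
          GaugeField.plaqHol (Averaging.iter (fun k => BlockAveraging.blockAvg (P := F.P K) (j := k) ℰp) (K - J - 1 - t)
            (fun ℓ => expPoint (ζ ℓ) * U₀ ℓ : GaugeField (F.P K) 0 (Matrix.specialUnitaryGroup (Fin 2) ℂ))) p)
        else 0)‖ ^ 2) t ≤
      2 * ((2 * Cst * (((5 ^ (F.P K).d : ℕ) : ℝ) ^ 2 * (((2 * ((2 * F.L + 1) + 2) + 1) ^ (F.P K).d * 6 : ℕ) : ℝ) *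
              (2 * ((((F.P K).L ^ (F.P K).d : ℕ) : ℝ) - 1) / ((((F.P K).L ^ (F.P K).d : ℕ) : ℝ) - 3)))) * (4 * (F.L : ℝ)⁻¹ * ((F.L : ℝ) ^ (K - J) * ∑ p : Plaq (F.P K) 0,
                  (1 - reTr ((GaugeField.plaqHol U₀ p)⁻¹ * GaugeField.plaqHol (fun ℓ => expPoint (ζ ℓ) * U₀ ℓ : GaugeField (F.P K) 0 (Matrix.specialUnitaryGroup (Fin 2) ℂ)) p))) + W *
      (12 * ((F.P K).d : ℝ) ^ 2 * (2 * ((F.P K).L : ℝ) ^ 2 * (3 * (F.P K).L + 2) + 2 * ((F.P K).L : ℝ) ^ 2 + (48 * (F.P K).L + 24 * ((((F.P K).d + 2) * (F.P K).L : ℕ) : ℝ) + 1616 * ((((F.P K).d + 2) * (F.P K).L : ℕ) : ℝ)) * (((((F.P K).d + 2) * (F.P K).L : ℕ) : ℝ) ^ 2 / 4) +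
        2 * ((((F.P K).d + 2) * (F.P K).L : ℕ) : ℝ) * ((F.L : ℝ) ^ 2)) ^ 2 * (2 * (C_B * α)) ^ 2 *
        (∑ t ∈ Finset.range (K - J), (if ht : t < K - J then
          (F.L : ℝ) ^ t * ∑ B : PBond (F.P J) 0,
            ‖(fun ℓ' : PBond (F.P (J + (t + 1))) 0 =>
              if ∃ z : Site (F.P (J + (t + 1))) 0,
                (B14.Eq22Determines.blockIter (t + 1) z = (bondShift (F.sitesPerDir_eq (m := F.m) (K := J) (j := 0) (m' := F.m) (K' := J + (t + 1)) (j' := t + 1) (by omega)) B).src ∨ B14.Eq22Determines.blockIter (t + 1) z = (bondShift (F.sitesPerDir_eq (m := F.m) (K := J) (j := 0) (m' := F.m) (K' := J + (t + 1)) (j' := t + 1) (by omega)) B).tgt) ∧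
                ∀ ν, (B10Eq27TorusAxialLog.rel z ℓ'.src ν).natAbs ≤ 2
              then logVec (su2Quat (descendTo F ℰp (J + (t + 1)) K (by omega) (fun ℓ => expPoint (ζ ℓ) * U₀ ℓ : GaugeField (F.P K) 0 (Matrix.specialUnitaryGroup (Fin 2) ℂ)) ℓ' * (descendTo F ℰp (J + (t + 1)) K (by omega) U₀ ℓ')⁻¹)) else 0)‖ ^ 2
        else 0)) / (F.L : ℝ) +
      48 * ∑ i ∈ Finset.range (K - J), w (i + 1) * (F.L : ℝ) ^ (K - J - 1 - (i + 1)) *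
          ∑ μ : Fin (F.P K).d, ∑ ν : Fin (F.P K).d, ∑ y' : Site (F.P K) (i + 1), R μ ν (i + 1) y' ^ 2 +
      3 * ∑ i ∈ Finset.range (K - J), w (i + 1) * (F.L : ℝ) ^ (K - J - 1 - (i + 1)) *
          ∑ μ : Fin (F.P K).d, ∑ ν : Fin (F.P K).d, ∑ y' : Site (F.P K) (i + 1),
            (if i = 0 then ((Fintype.card (Idx (F.P K)) : ℝ)⁻¹ *
            ∑ a ∈ (Finset.univ : Finset (Idx (F.P K))) ×ˢ (Finset.range (F.P K).L ×ˢ Finset.range (F.P K).L),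
              (Real.exp (‖X i ⟨(shiftN (shiftN (Site.blockSite y' a.1.1) μ a.2.1) ν a.2.2), μ⟩‖ + ‖X i ⟨((shiftN (shiftN (Site.blockSite y' a.1.1) μ a.2.1) ν a.2.2)).shift μ, ν⟩‖ + ‖X i ⟨((shiftN (shiftN (Site.blockSite y' a.1.1) μ a.2.1) ν a.2.2)).shift ν, μ⟩‖ + ‖X i ⟨(shiftN (shiftN (Site.blockSite y' a.1.1) μ a.2.1) ν a.2.2), ν⟩‖) - 1 - (‖X i ⟨(shiftN (shiftN (Site.blockSite y' a.1.1) μ a.2.1) ν a.2.2), μ⟩‖ + ‖X i ⟨((shiftN (shiftN (Site.blockSite y' a.1.1) μ a.2.1) ν a.2.2)).shift μ, ν⟩‖ + ‖X i ⟨((shiftN (shiftN (Site.blockSite y' a.1.1) μ a.2.1) ν a.2.2)).shift ν, μ⟩‖ + ‖X i ⟨(shiftN (shiftN (Site.blockSite y' a.1.1) μ a.2.1) ν a.2.2), ν⟩‖))) else 0) ^ 2))) +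
      2 * ((256 * Cst * Mbar ^ 2 * ((2 * (F.P J).d * (2 * 3 + 1) ^ (F.P J).d : ℕ) : ℝ)) * (∑ t ∈ Finset.range (K - J), (if ht : t < K - J then
          (F.L : ℝ) ^ t * ∑ B : PBond (F.P J) 0,
            ‖(fun ℓ' : PBond (F.P (J + (t + 1))) 0 =>
              if ∃ z : Site (F.P (J + (t + 1))) 0,
                (B14.Eq22Determines.blockIter (t + 1) z = (bondShift (F.sitesPerDir_eq (m := F.m) (K := J) (j := 0) (m' := F.m) (K' := J + (t + 1)) (j' := t + 1) (by omega)) B).src ∨ B14.Eq22Determines.blockIter (t + 1) z = (bondShift (F.sitesPerDir_eq (m := F.m) (K := J) (j := 0) (m' := F.m) (K' := J + (t + 1)) (j' := t + 1) (by omega)) B).tgt) ∧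
                ∀ ν, (B10Eq27TorusAxialLog.rel z ℓ'.src ν).natAbs ≤ 2
              then logVec (su2Quat (descendTo F ℰp (J + (t + 1)) K (by omega) (fun ℓ => expPoint (ζ ℓ) * U₀ ℓ : GaugeField (F.P K) 0 (Matrix.specialUnitaryGroup (Fin 2) ℂ)) ℓ' * (descendTo F ℰp (J + (t + 1)) K (by omega) U₀ ℓ')⁻¹)) else 0)‖ ^ 2
        else 0))) := by
  have hL2 : (2 : ℝ) ≤ (F.L : ℝ) := by exact_mod_cast F.hL.2
  have hL1 : (1 : ℝ) ≤ (F.L : ℝ) := by linarith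
  obtain ⟨αc, δc, αpc, αpbc, h1, h2, h3, h4, h5, h6, h7, h8, h9, h10, h11, hδr, hαr, hαpr⟩ :=
    exists_srcClasses_of_bkg' F U₀ C_B α hCB hα hpos hL1 hBKG h24 hSU (2 * (C_B * α)) le_rfl
  have hV2 := Elin_le_beta_Sprime F hJK U₀ ζ X hXdef αc δc αpbc (2 * (C_B * α))
    (((((F.P K).d + 2) * (F.P K).L : ℕ) : ℝ) ^ 2 / 4) ((F.L : ℝ) ^ 2) hδr hαr hαpr h9 h4 h11
  -- the ℓ²-corner size as an opaque size letter `M` with its three properties (✓p839415 `cornerM_*`)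
  obtain ⟨M, hM', hXM, hEM⟩ : ∃ M : Fin (F.P K).d → Fin (F.P K).d → (i : ℕ) → Site (F.P K) i → ℝ,
      (∀ μ ν i x, 0 ≤ M μ ν i x) ∧
      (∀ μ ν : Fin (F.P K).d, μ < ν → ∀ i, i < K - J → ∀ (y' : Site (F.P K) (i + 1)) (b : PBond (F.P K) i),
      (blockOf b.src = y' ∨ blockOf b.src = y'.shift μ ∨ blockOf b.src = y'.shift ν ∨ blockOf b.src = (y'.shift μ).shift ν) → ‖X i b‖ ≤ M μ ν (i + 1) y') ∧
      (∀ i, i < K - J → ∑ μ : Fin (F.P K).d, ∑ ν : Fin (F.P K).d, ∑ y' : Site (F.P K) (i + 1), M μ ν (i + 1) y' ^ 2 ≤ 4 * ((F.P K).d : ℝ) ^ 2 * ∑ b : PBond (F.P K) i, ‖X i b‖ ^ 2) :=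
    ⟨_, cornerM_nonneg F X, cornerM_dominates F X, fun i _ => cornerM_energy F X i⟩
  refine c1Budget_of_letters F hJK Cst hCst U₀ ζ w hw W hW X hXdef Mg hMg hMg4 αc δc αpc h1 h2 h3 h4 h5 h6 h7 h8
    M hM' hXM R hR0 hR _ ?_ Mbar hM0 hM1 hM
  refine (Bsrc_split_le F X w hw αc δc αpc αpbc h4 h9 h7 h10 M
    (fun i => 4 * ((F.P K).d : ℝ) ^ 2 * ∑ b : PBond (F.P K) i, ‖X i b‖ ^ 2) hEM R).trans ?_
  refine add_le_add (add_le_add ?_ le_rfl) le_rfl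
  refine le_trans ?_ hV2
  refine mul_le_mul_of_nonneg_left (Finset.sum_le_sum fun i hi => ?_) (by norm_num)
  have hwi := hwdom i (Finset.mem_range.1 hi)
  gcongr

end Summit.QuantumFields.YangMills.Theorems.FluctuationComparisonRegPrIntLS2BetaCurlBudgetOfBkg

end
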